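import Literature.MathematicalPhysics.QuantumFieldTheory.Balaban1983to89.B11Ineq189Transpose
import Literature.MathematicalPhysics.QuantumFieldTheory.Balaban1983to89.B11TracePairingLetters
import Literature.MathematicalPhysics.QuantumFieldTheory.Balaban1983to89.B11Ineq189D2DDecayConcrete
import Literature.MathematicalPhysics.QuantumFieldTheory.Balaban1983to89.B11HKernelHasMajConcrete

/-!
# `Balaban1983to89.B11Ineq189TransposeCube` — the transposition bookkeeping of [Balaban1985Variational] (189) ON THE
# CARRIERS OF RECORD of the (73)∕(189) chain: `U(N)`-matrix-valued bond configurations over the single-scale cube geometry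
# `B11Ineq73HasMajConcrete.cubeGeometry` with its sharp boxes `boxS`∕`boxT` — every letter of `B11Ineq189Transpose`
# DISCHARGED (trace form, `C = 1`, `N = n·#bonds`), so a primal majorant of a family `Φ` IS a majorant of `transposeOf₂ Φ`

statement-level skeleton of published theorems with citation tags; proofs where landed; nothing here is a claim about
the Yang–Mills mass gap.

CITATION HEADER (lean-in-tree rule 2026-08-18).  [Balaban1985Variational] = T. Bałaban, Commun. Math. Phys. **102** (1985)
277–309: (73) p. 289 (the kernel of `𝔇(A′)` between a coarse bond `c` and the fine bonds of the cube `B^j(y)`), (85)–(90)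
pp. 291–292 (the transposed kernels `𝔇*`, `H*`, the scalar products over bonds), (189)–(190) p. 308; [Balaban1984PropagatorsII]
(2.51)–(2.54) pp. 232–233, Lemma 2.1 p. 234.  Nothing of the series is asserted: the module instantiates the abstract
transposition theorems of `B11Ineq189Transpose` (p416995) with the trace-form letters of `B11TracePairingLetters` on the cube
geometry of `B11Ineq73HasMajConcrete`; every majorant of a concrete operator remains a HYPOTHESIS of the printed shape.

WHY (YM-DAG node N07 = [B11], -b₂ seat `pub-ymgap-dag-n21-b` g2; dag-lead [DAGLEAD-G2-REBALANCE-32]; n07-b's cut «the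
TRANSPOSED families δ𝔇*, 𝔇*, H* … NOT concrete»): this is the module after which they ARE concrete — given any primal
majorant on the cube carriers (e.g. n07-b's `B11Ineq189D2DDecayConcrete.hasMaj₂_d2_Dfix_concrete` read at `𝔸 = Matrix n n ℂ`,
or the (73) letter `B11Ineq73HasMajConcrete.hasMaj_fderiv_Dfix`, or an `H` of `B11HKernelHasMajConcrete`), the transposed
operator `transposeOf T` ∕ family `transposeOf₂ Φ` has the transposed majorant with the explicit constants below, by ONE call.

WHAT IS PROVED.
* §1 cube-geometry bookkeeping: `dist_symm_cubeGeometry` (`|y − y′|₁ = |y′ − y|₁`), `mem_boxS_iff` ∕ `mem_boxT_iff` (boxes =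
  blocks), `card_mul_boxS_le` ∕ `card_mul_boxT_le` (the Hölder constants `n·#S`, `n·#T` — crude but uniform).
* §2 **`hasMaj_transpose_cubeS`∕`…_cubeT`** (one operator, fine → coarse resp. coarse → fine, exponential majorant `a·e^{−ρd}` ↦
  `(n·#bonds)·a·e^{−ρd}` — orientation-free shape, cf. `hasMaj_transpose_of_adjoint_exp`) and **`hasMaj₂_transpose_cube`** (a family
  fine × fine → coarse, the shape of `δ𝔇(A′)[𝔄]`: joint majorant `θ·e^{−ρd(y,y″)}·e^{−ρ′d(y,y′)}` ↦ `(n·#T)·θ·e^{−ρd(y,y″)}·e^{−ρ′d(y″,y′)}`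
  for `transposeOf₂ Φ`, centred at the contracted block).
* §3 **`term189_transpose_cube`** — the SHAPE-B row on the cube from a PRIMAL family: `𝔄 ↦ (Φ𝔄)ᵗX` for a fixed coarse
  configuration `X` of sup size `≤ M` has the majorant `(n·#T)·θ·M·c₀(δ₀,α)ᵈ·e^{−ρ₀d(y,y′)}` for every `ρ₀ ≥ 0` with `ρ₀ ≤ ρ′`,
  `ρ₀ + αδ₀ ≤ ρ` (row sum of Lemma 2.1 on the cube, `rowSum_cubeGeometry`) — the located rate cost of `B11Ineq189Transpose` §2
  on the carriers of record.
* §4 **`hasMaj₂_d2_Dfix_concrete_transpose`** — THE CONCRETE `δ𝔇*`: n07-b's `B11Ineq189D2DDecayConcrete.hasMaj₂_d2_Dfix_concrete`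
  (δ𝔇 = (δ²∕δA′²)D(A′) for the Prop. 3 selector `Dfix (C_j(U₀,·)) H (C₂(Lʲ)²)`, hypotheses VERBATIM) read at `𝔸 = Matrix n n ℂ` and
  transposed in its `μ`-slot by §2: `transposeOf₂ Φ` has the joint majorant `(n·#T)·(2∕ε)θ_D·e^{−¼δ₀|y−y″|₁}·e^{−¼δ₀|y″−y′|₁}` — the
  first transposed family of the (189) census that is a theorem at concrete letters; and **`term189_d2_Dfix_concrete_transpose`** — the
  transposed SHAPE-B row at the concrete `δ𝔇` (fixed coarse `X`, rate `⅛δ₀`, constant `(n·#T)·(2∕ε)θ_D·M·c₀(δ₀,⅛)ᵈ`), the companion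
  of n07-b's `term189_d2_Dfix_concrete`.

HONEST SCOPE.  Theorems only (0 def); the majorants of the concrete operators are hypotheses; the Hölder constant is the crude
`n·#T` (a per-site bond count `d` would do — bookkeeping, not attempted); nothing of (73), (85)–(96), (189) asserted; 0 sorry;
axioms standard.  One finite T⁴ programme at fixed `ε` upstream — NOT infinite volume, NOT OS on ℝ⁴, NOT a mass gap, NOT Clay.
-/

namespace Literature.MathematicalPhysics.QuantumFieldTheory.Balaban1983to89.B11Ineq189TransposeCube

open Finset B6RandomWalk B11SectG B11Ineq189 B11SupSize190 B11Ineq189Transpose B11TracePairing B11TracePairingLetters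
  B11Ineq73HasMajConcrete
open scoped Matrix Matrix.Norms.L2Operator

noncomputable section

variable {d : ℕ} {ν : Type} [Fintype ν] [DecidableEq ν]

/-! ## §1  Cube-geometry bookkeeping: symmetric distance, boxes = blocks, the Hölder constants -/

section Cube

variable (L j : ℕ) (S T : Finset (B7Prop1Explicit.Site d × Fin d))

/-- The block distance `|y − y′|₁` of the cube geometry is symmetric. [cite: Balaban1984PropagatorsII, (2.46) p.229] -/
theorem dist_symm_cubeGeometry (y y' : (cubeGeometry L j S T).Site) :
    (cubeGeometry L j S T).dist y y' = (cubeGeometry L j S T).dist y' y := by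
  rw [dist_cubeGeometry, dist_cubeGeometry, ← neg_sub, B7Prop1Explicit.l1_neg]

/-- The sharp box of the fine bonds IS the block: `s ∈ boxS y ↔ blkS s = y`. [cite: Balaban1985Variational, (190) p.308] -/
theorem mem_boxS_iff (y : (cubeGeometry L j S T).Site) (s : S) : s ∈ boxS L j S T y ↔ blkS L j S T s = y := by
  simp [boxS]

/-- The sharp box of the coarse bonds IS the block: `c ∈ boxT y ↔ blkT c = y`. [cite: Balaban1985Variational, (190) p.308] -/
theorem mem_boxT_iff (y : (cubeGeometry L j S T).Site) (c : T) : c ∈ boxT L j S T y ↔ blkT L j S T c = y := by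
  simp [boxT]

omit [DecidableEq ν] in
/-- The crude Hölder constant of the fine boxes: `n·#boxS(y) ≤ n·#S`. [cite: Balaban1985Variational, (190) p.308] -/
theorem card_mul_boxS_le (y : (cubeGeometry L j S T).Site) :
    (Fintype.card ν : ℝ) * (boxS L j S T y).card ≤ Fintype.card ν * S.card := by
  refine mul_le_mul_of_nonneg_left ?_ (Nat.cast_nonneg _)
  exact_mod_cast (Finset.card_le_univ (boxS L j S T y)).trans (le_of_eq (Fintype.card_coe S))

omit [DecidableEq ν] in
/-- The crude Hölder constant of the coarse boxes: `n·#boxT(y) ≤ n·#T`. [cite: Balaban1985Variational, (190) p.308] -/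
theorem card_mul_boxT_le (y : (cubeGeometry L j S T).Site) :
    (Fintype.card ν : ℝ) * (boxT L j S T y).card ≤ Fintype.card ν * T.card := by
  refine mul_le_mul_of_nonneg_left ?_ (Nat.cast_nonneg _)
  exact_mod_cast (Finset.card_le_univ (boxT L j S T y)).trans (le_of_eq (Fintype.card_coe T))

end Cube

/-! ## §2  Transposition on the cube carriers: the letters discharged -/

section Transpose

variable (L j : ℕ) (S T : Finset (B7Prop1Explicit.Site d × Fin d))

/-- **ONE OPERATOR, FINE → COARSE** (the shape of `𝔇(A′)` of (73)): if `Tm : (S → 𝔸) → (T → 𝔸)`, `𝔸 = Matrix n n ℂ`, has the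
majorant `a·e^{−ρd}` between the fine and the coarse sup sizes of the cube geometry (`a ≥ 0`), then `transposeOf Tm` (coarse → fine)
has the majorant `(n·#T)·a·e^{−ρd}` — `B11Ineq189Transpose.hasMaj_transpose_of_adjoint_exp` with `C = 1` (`dual_supSize_trForm`),
`N = n·#T` (`holder_supSize_trForm`), adjoint identity `trForm_transposeOf`. [cite: Balaban1985Variational, (73) p.289 + (88) p.291] -/
theorem hasMaj_transpose_cubeS {Tm : (S → Matrix ν ν ℂ) →ₗ[ℝ] (T → Matrix ν ν ℂ)} {a ρ : ℝ} (ha : 0 ≤ a)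
    (h : HasMaj (supSize (cubeGeometry L j S T) (boxS L j S T) (blkS L j S T) :
        BlockNorm (cubeGeometry L j S T) (S → Matrix ν ν ℂ))
      (supSize (cubeGeometry L j S T) (boxT L j S T) (blkT L j S T) :
        BlockNorm (cubeGeometry L j S T) (T → Matrix ν ν ℂ))
      Tm (fun y y' => a * Real.exp (-(ρ * (cubeGeometry L j S T).dist y y')))) :
    HasMaj (supSize (cubeGeometry L j S T) (boxT L j S T) (blkT L j S T) :
        BlockNorm (cubeGeometry L j S T) (T → Matrix ν ν ℂ))
      (supSize (cubeGeometry L j S T) (boxS L j S T) (blkS L j S T) :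
        BlockNorm (cubeGeometry L j S T) (S → Matrix ν ν ℂ))
      (transposeOf Tm)
      (fun y y' => 1 * (Fintype.card ν * T.card) * a * Real.exp (-(ρ * (cubeGeometry L j S T).dist y y'))) :=
  hasMaj_transpose_of_adjoint_exp (p₁ := fun μ f => trForm μ f) (p₂ := fun f w => trForm f w)
    (dist_symm_cubeGeometry L j S T) (by positivity) ha
    (fun μ w => trForm_transposeOf Tm μ w)
    (fun y f s hs => dual_supSize_trForm (mem_boxS_iff L j S T) y f s hs)
    (fun y w hw f => holder_supSize_trForm (mem_boxT_iff L j S T) (card_mul_boxT_le L j S T) y w hw f) h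

/-- **ONE OPERATOR, COARSE → FINE** (the shape of `H` of (46) ∕ [5] Thm 3.12): majorant `a·e^{−ρd}` of `Hm : (T → 𝔸) → (S → 𝔸)`
⇒ majorant `(n·#S)·a·e^{−ρd}` of `transposeOf Hm`. [cite: Balaban1985Variational, (46) p.285 + (90) p.291] -/
theorem hasMaj_transpose_cubeT {Hm : (T → Matrix ν ν ℂ) →ₗ[ℝ] (S → Matrix ν ν ℂ)} {a ρ : ℝ} (ha : 0 ≤ a)
    (h : HasMaj (supSize (cubeGeometry L j S T) (boxT L j S T) (blkT L j S T) :
        BlockNorm (cubeGeometry L j S T) (T → Matrix ν ν ℂ))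
      (supSize (cubeGeometry L j S T) (boxS L j S T) (blkS L j S T) :
        BlockNorm (cubeGeometry L j S T) (S → Matrix ν ν ℂ))
      Hm (fun y y' => a * Real.exp (-(ρ * (cubeGeometry L j S T).dist y y')))) :
    HasMaj (supSize (cubeGeometry L j S T) (boxS L j S T) (blkS L j S T) :
        BlockNorm (cubeGeometry L j S T) (S → Matrix ν ν ℂ))
      (supSize (cubeGeometry L j S T) (boxT L j S T) (blkT L j S T) :
        BlockNorm (cubeGeometry L j S T) (T → Matrix ν ν ℂ))
      (transposeOf Hm)
      (fun y y' => 1 * (Fintype.card ν * S.card) * a * Real.exp (-(ρ * (cubeGeometry L j S T).dist y y'))) :=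
  hasMaj_transpose_of_adjoint_exp (p₁ := fun μ f => trForm μ f) (p₂ := fun f w => trForm f w)
    (dist_symm_cubeGeometry L j S T) (by positivity) ha
    (fun μ w => trForm_transposeOf Hm μ w)
    (fun y f s hs => dual_supSize_trForm (mem_boxT_iff L j S T) y f s hs)
    (fun y w hw f => holder_supSize_trForm (mem_boxS_iff L j S T) (card_mul_boxS_le L j S T) y w hw f) h

variable {FA : Type} [AddCommGroup FA] [Module ℝ FA] {bA : BlockNorm (cubeGeometry L j S T) FA}

/-- **A FAMILY FINE × FINE → COARSE** (the shape of `δ𝔇(A′)[𝔄]`, n07-b's `hasMaj₂_d2_Dfix_concrete` read at `𝔸 = Matrix n n ℂ`):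
a joint majorant `θ·e^{−ρd(y,y″)}·e^{−ρ′d(y,y′)}` of `Φ` (direction `𝔄` measured by any block size `bA`, `μ` by the fine sup size,
output by the coarse sup size) IS the joint majorant `(n·#T)·θ·e^{−ρd(y,y″)}·e^{−ρ′d(y″,y′)}` of the transposed family `transposeOf₂ Φ`
(coarse `w` in, fine out) — CENTRED AT THE CONTRACTED BLOCK. [cite: Balaban1985Variational, (189) p.308 + (88) p.291] -/
theorem hasMaj₂_transpose_cube {Φ : FA →ₗ[ℝ] (S → Matrix ν ν ℂ) →ₗ[ℝ] (T → Matrix ν ν ℂ)} {θ ρ ρ' : ℝ} (hθ : 0 ≤ θ)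
    (h : HasMaj₂ bA
      (supSize (cubeGeometry L j S T) (boxS L j S T) (blkS L j S T) :
        BlockNorm (cubeGeometry L j S T) (S → Matrix ν ν ℂ))
      (supSize (cubeGeometry L j S T) (boxT L j S T) (blkT L j S T) :
        BlockNorm (cubeGeometry L j S T) (T → Matrix ν ν ℂ))
      Φ (fun y y'' y' => θ * Real.exp (-(ρ * (cubeGeometry L j S T).dist y y'')) *
        Real.exp (-(ρ' * (cubeGeometry L j S T).dist y y')))) :
    HasMaj₂ bA
      (supSize (cubeGeometry L j S T) (boxT L j S T) (blkT L j S T) :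
        BlockNorm (cubeGeometry L j S T) (T → Matrix ν ν ℂ))
      (supSize (cubeGeometry L j S T) (boxS L j S T) (blkS L j S T) :
        BlockNorm (cubeGeometry L j S T) (S → Matrix ν ν ℂ))
      (transposeOf₂ Φ)
      (fun y y'' y' => 1 * (Fintype.card ν * T.card) * θ * Real.exp (-(ρ * (cubeGeometry L j S T).dist y y'')) *
        Real.exp (-(ρ' * (cubeGeometry L j S T).dist y'' y'))) :=
  hasMaj₂_transpose_of_adjoint_exp (p₁ := fun μ f => trForm μ f) (p₂ := fun f w => trForm f w)
    (dist_symm_cubeGeometry L j S T) (by positivity) hθ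
    (fun v μ w => trForm_transposeOf₂ Φ v μ w)
    (fun y f s hs => dual_supSize_trForm (mem_boxS_iff L j S T) y f s hs)
    (fun y w hw f => holder_supSize_trForm (mem_boxT_iff L j S T) (card_mul_boxT_le L j S T) y w hw f) h

/-! ## §3  The SHAPE-B row on the cube from a primal family, with the located rate cost -/

/-- **THE TRANSPOSED SHAPE-B ROW ON THE CARRIERS OF RECORD.**  From a PRIMAL joint majorant `θ·e^{−ρd(y,y″)}·e^{−ρ′d(y,y′)}` of a
family `Φ` (fine × fine → coarse) and a FIXED coarse configuration `X` of sup size `≤ M` everywhere, the operator `𝔄 ↦ (Φ𝔄)ᵗX`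
(fine-valued) has the majorant `(n·#T)·θ·M·c₀(δ₀,α)ᵈ·e^{−ρ₀d(y,y′)}` for every `ρ₀ ≥ 0` with `ρ₀ ≤ ρ′` and `ρ₀ + αδ₀ ≤ ρ` (`αδ₀ > 0`
the rate at which Lemma 2.1's row sum on the cube is taken, `rowSum_cubeGeometry`).  With n07-b's concrete `(ρ, ρ′) = (¼δ₀, ¼δ₀)`
and `α = ⅛`: `ρ₀ = ⅛δ₀`; at (189)'s `¼δ₀` the primal letter is needed at `(⅜δ₀, ¼δ₀)` (`B11Ineq189Transpose` §2).
[cite: Balaban1985Variational, (189) p.308 + (88) p.291; Balaban1984PropagatorsII, Lemma 2.1 p.234] -/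
theorem term189_transpose_cube {Φ : FA →ₗ[ℝ] (S → Matrix ν ν ℂ) →ₗ[ℝ] (T → Matrix ν ν ℂ)} {X : T → Matrix ν ν ℂ}
    {W : FA →ₗ[ℝ] (S → Matrix ν ν ℂ)} {θ ρ ρ' ρ₀ δ₀ α M : ℝ} (hθ : 0 ≤ θ) (hM : 0 ≤ M) (hαδ : 0 < α * δ₀) (hρ₀ : 0 ≤ ρ₀)
    (h1 : ρ₀ ≤ ρ') (h2 : ρ₀ + α * δ₀ ≤ ρ)
    (h : HasMaj₂ bA
      (supSize (cubeGeometry L j S T) (boxS L j S T) (blkS L j S T) :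
        BlockNorm (cubeGeometry L j S T) (S → Matrix ν ν ℂ))
      (supSize (cubeGeometry L j S T) (boxT L j S T) (blkT L j S T) :
        BlockNorm (cubeGeometry L j S T) (T → Matrix ν ν ℂ))
      Φ (fun y y'' y' => θ * Real.exp (-(ρ * (cubeGeometry L j S T).dist y y'')) *
        Real.exp (-(ρ' * (cubeGeometry L j S T).dist y y'))))
    (hX : ∀ y, (supSize (cubeGeometry L j S T) (boxT L j S T) (blkT L j S T) :
        BlockNorm (cubeGeometry L j S T) (T → Matrix ν ν ℂ)).loc y X ≤ M)
    (hW : ∀ v, W v = transposeOf₂ Φ v X) :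
    HasMaj bA
      (supSize (cubeGeometry L j S T) (boxS L j S T) (blkS L j S T) :
        BlockNorm (cubeGeometry L j S T) (S → Matrix ν ν ℂ))
      W (fun y y' => 1 * (1 * (Fintype.card ν * T.card) * θ) * M * B6.c0 δ₀ α ^ d *
        Real.exp (-(ρ₀ * (cubeGeometry L j S T).dist y y'))) := by
  have hrow : RowSum (cubeGeometry L j S T) (α * δ₀) (B6.c0 δ₀ α ^ d) := rowSum_cubeGeometry L j S T hαδ
  have ht := hasMaj₂_transpose_cube L j S T hθ h
  have hκ : (supSize (cubeGeometry L j S T) (boxT L j S T) (blkT L j S T) :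
      BlockNorm (cubeGeometry L j S T) (T → Matrix ν ν ℂ)).κ = 1 := supSize_κ
  rw [← hκ]
  exact hasMaj_apply_bounded_centred (triangle254_cubeGeometry L j S T) (dist_nonneg_cubeGeometry L j S T) hrow
    (mul_nonneg (mul_nonneg zero_le_one (by positivity)) hθ) hM hρ₀ h1 h2 ht hX hW

end Transpose

/-! ## §4  The concrete `δ𝔇*`: n07-b's `δ𝔇` letter at `𝔸 = Matrix n n ℂ`, transposed -/

section ConcreteD2

open B7Prop1Explicit B7Prop1Local B7Prop2Explicit B7Prop3Flat B7Prop5GeneralLevels B11Eq44Concrete B11Prop3Model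
  B11Prop3Concrete B11Ineq189D2DDecayConcrete

variable [Nonempty ν]
variable (L : ℕ) (hL : 2 ≤ L) {G : Subgroup (Matrix ν ν ℂ)ˣ} (hG : AvgClosed d L G) (k : ℕ)
  (U₀ : B7Prop1Explicit.Site d → Fin d → (Matrix ν ν ℂ)ˣ) (hU₀ : ∀ x κ, U₀ x κ ∈ G) {α₀ : ℝ} (hα : 0 < α₀)
  (hα3 : C0 d * α₀ ≤ 1 / 3) (hα4 : 4 * α₀ ≤ c2' d L) (h52 : pdev U₀ < α₀ * (((L : ℝ) ^ k)⁻¹) ^ 2)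
  {b : ℝ} (hb : 0 < b)
  (hsmall : Real.exp (4 * (800 * ((d : ℝ) + 1) ^ 2 * ((d : ℝ) + 4)) * α₀)
    * (1 + 8 * (131072 * ((d : ℝ) + 1) ^ 2) * ((L : ℝ) ^ k * b)) ≤ 2)
  (hc₃ : 4 * ((L : ℝ) ^ k * b) < c3 d L)
  (h145 : 8 * d * thetaGen d L α₀ * (L : ℝ)⁻¹ ^ 4 ≤ 1)
  (h155 : (2 * (L : ℝ) - 1) * (L : ℝ)⁻¹ ^ 2 + 2 * d * thetaGen d L α₀ * (L : ℝ)⁻¹ ^ 3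
    + 1 / 8 * (1 + 2 * d * thetaGen d L α₀ * (L : ℝ)⁻¹ ^ 2 + 2 * d * C3Gen d L * ((L : ℝ) ^ k * b)) * (L : ℝ)⁻¹ ^ 2 ≤ 1)
  (S T : Finset (B7Prop1Explicit.Site d × Fin d)) (H : (T → Matrix ν ν ℂ) →L[ℂ] (S → Matrix ν ν ℂ)) {B₀ B₁ δ₀ ε : ℝ}

include hL hG hU₀ hα hα3 hα4 h52 hb hsmall hc₃ h145 h155 in
/-- **THE CONCRETE TRANSPOSED FAMILY `δ𝔇*[𝔄]`** (n07-b's cut «δ𝔇* … NOT concrete» closed at the majorant level for `U(N)`-matrix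
values): under EXACTLY the hypotheses of `B11Ineq189D2DDecayConcrete.hasMaj₂_d2_Dfix_concrete` (δ𝔇 = the second Fréchet derivative of
the Prop. 3 selector `D = Dfix (C_j(U₀,·)) H (C₂(Lʲ)²)` at `‖A′‖ < ½ε`, read as the ℝ-bilinear family `Φ`), specialised to
`𝔸 = Matrix n n ℂ` with the operator norm of [B7] (19): the TRANSPOSED family `transposeOf₂ Φ` — `𝔄 ↦ (δ𝔇(A′)[𝔄])ᵗ` for the trace
form over bonds, coarse configuration in, fine configuration out — has the joint majorant
`(n·#T)·(2∕ε)θ_D·e^{−¼δ₀|y−y″|₁}·e^{−¼δ₀|y″−y′|₁}` between the sup sizes of the cube geometry (`y″` = the block of the contracted coarse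
argument, `y′` = the block of `𝔄`).  One call of `hasMaj₂_transpose_cube`; nothing of (73)∕(189) asserted beyond n07-b's theorem.
[cite: Balaban1985Variational, (189) p.308 + (88) p.291 + (73) p.289] -/
theorem hasMaj₂_d2_Dfix_concrete_transpose {j : ℕ} (hj : j ≤ k) (hd : 1 ≤ d) (hB₀ : 0 ≤ B₀)
    (hH : ∀ X, ‖H X‖ ≤ B₀ * ‖X‖) {c1h : ℝ} (hc1h : 1 ≤ c1h) (hε : 0 < ε)
    (h18 : 18 * ((8 * (131072 * ((d : ℝ) + 1) ^ 2) * Real.exp (4 * (800 * ((d : ℝ) + 1) ^ 2 * ((d : ℝ) + 4)) * α₀)) *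
      ((L : ℝ) ^ j) ^ 2) * B₀ * d * c1h * ε ≤ 1) (h2 : 2 * ε ≤ b / 2)
    (hq9 : 9 * ((8 * (131072 * ((d : ℝ) + 1) ^ 2) * Real.exp (4 * (800 * ((d : ℝ) + 1) ^ 2 * ((d : ℝ) + 4)) * α₀))
      * ((L : ℝ) ^ j) ^ 2) * B₀ * ε < 1) (hε3 : 3 * ε < b)
    (hδ₀ : 0 < δ₀) (hB₁ : 0 ≤ B₁)
    (hHker : ∀ (c'' : T) (Y : Matrix ν ν ℂ) (s : S),
      ‖H (Pi.single c'' Y) s‖ ≤ B₁ * Real.exp (-(δ₀ * ((B7Prop1Explicit.l1 (loK L j c''.1.1 - s.1.1) : ℝ) / (L : ℝ) ^ j))) * ‖Y‖)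
    (hq : (C3Gen d L * (((L : ℝ) ^ j) ^ 2 * (2 * ε)) * (2 * d) * B₁ * Real.exp (2 * d * δ₀)) * (d * B6.c0 δ₀ (1 / 2) ^ d) < 1)
    {A' : S → Matrix ν ν ℂ} (hA : ‖A'‖ < ε / 2)
    (Φ : (S → Matrix ν ν ℂ) →ₗ[ℝ] (S → Matrix ν ν ℂ) →ₗ[ℝ] (T → Matrix ν ν ℂ))
    (hΦ : ∀ (v μ : S → Matrix ν ν ℂ) (c : T), Φ v μ c = fderiv ℂ (fun Y : S → Matrix ν ν ℂ => fderiv ℂ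
        (Dfix (Cmap L U₀ S T j) (H : (T → Matrix ν ν ℂ) →ₗ[ℂ] (S → Matrix ν ν ℂ)) ((8 * (131072 * ((d : ℝ) + 1) ^ 2) *
          Real.exp (4 * (800 * ((d : ℝ) + 1) ^ 2 * ((d : ℝ) + 4)) * α₀)) * ((L : ℝ) ^ j) ^ 2)) Y μ) A' v c) :
    HasMaj₂ (supSize (cubeGeometry L j S T) (boxS L j S T) (blkS L j S T) :
        BlockNorm (cubeGeometry L j S T) (S → Matrix ν ν ℂ))
      (supSize (cubeGeometry L j S T) (boxT L j S T) (blkT L j S T) :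
        BlockNorm (cubeGeometry L j S T) (T → Matrix ν ν ℂ))
      (supSize (cubeGeometry L j S T) (boxS L j S T) (blkS L j S T) :
        BlockNorm (cubeGeometry L j S T) (S → Matrix ν ν ℂ))
      (transposeOf₂ Φ)
      (fun y y'' y' => 1 * (Fintype.card ν * T.card) * (2 / ε * (d * Real.exp (1 / 2 * d * δ₀) *
          ((1 - (C3Gen d L * (((L : ℝ) ^ j) ^ 2 * (2 * ε)) * (2 * d) * B₁ * Real.exp (2 * d * δ₀)) *
              (d * B6.c0 δ₀ (1 / 2) ^ d))⁻¹ * (Real.exp (d * δ₀) * (C3Gen d L * ((L : ℝ) ^ j) ^ 2 * (2 * ε)))))) *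
        Real.exp (-(δ₀ / 4 * (cubeGeometry L j S T).dist y y'')) *
        Real.exp (-(δ₀ / 4 * (cubeGeometry L j S T).dist y'' y'))) := by
  have h := hasMaj₂_d2_Dfix_concrete L hL hG k U₀ hU₀ hα hα3 hα4 h52 hb hsmall hc₃ h145 h155 S T H hj hd hB₀ hH hc1h hε h18 h2
    hq9 hε3 hδ₀ hB₁ hHker hq hA Φ hΦ
  have hQ1 : 0 < 1 - (C3Gen d L * (((L : ℝ) ^ j) ^ 2 * (2 * ε)) * (2 * d) * B₁ * Real.exp (2 * d * δ₀)) *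
      (d * B6.c0 δ₀ (1 / 2) ^ d) := by linarith
  have hC3 : 0 ≤ C3Gen d L := by unfold C3Gen C1ppGen; positivity
  exact hasMaj₂_transpose_cube L j S T (by positivity) h

include hL hG hU₀ hα hα3 hα4 h52 hb hsmall hc₃ h145 h155 in
/-- **THE TRANSPOSED SHAPE-B ROW AT THE CONCRETE `δ𝔇`** (companion of n07-b's `term189_d2_Dfix_concrete`, which contracts the
UNtransposed family): for a FIXED COARSE configuration `X` of sup size `≤ M` on every block, the operator `W𝔄 := (δ𝔇(A′)[𝔄])ᵗX`
(fine-valued) is a (189)-type term between the fine sup sizes with constant `(n·#T)·(2∕ε)θ_D·M·c₀(δ₀,⅛)ᵈ` at the rate `⅛δ₀` that the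
tree's `(¼δ₀, ¼δ₀)` split affords after transposition (`term189_transpose_cube` with `α = ⅛`; `B11Ineq189Transpose` §2 records why
`¼δ₀` needs (73) read at `⅝δ₀`). [cite: Balaban1985Variational, (189) p.308 + (85)–(90) pp.291–292 + (73) p.289; Balaban1984PropagatorsII, Lemma 2.1 p.234] -/
theorem term189_d2_Dfix_concrete_transpose {j : ℕ} (hj : j ≤ k) (hd : 1 ≤ d) (hB₀ : 0 ≤ B₀)
    (hH : ∀ X, ‖H X‖ ≤ B₀ * ‖X‖) {c1h : ℝ} (hc1h : 1 ≤ c1h) (hε : 0 < ε)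
    (h18 : 18 * ((8 * (131072 * ((d : ℝ) + 1) ^ 2) * Real.exp (4 * (800 * ((d : ℝ) + 1) ^ 2 * ((d : ℝ) + 4)) * α₀)) *
      ((L : ℝ) ^ j) ^ 2) * B₀ * d * c1h * ε ≤ 1) (h2 : 2 * ε ≤ b / 2)
    (hq9 : 9 * ((8 * (131072 * ((d : ℝ) + 1) ^ 2) * Real.exp (4 * (800 * ((d : ℝ) + 1) ^ 2 * ((d : ℝ) + 4)) * α₀))
      * ((L : ℝ) ^ j) ^ 2) * B₀ * ε < 1) (hε3 : 3 * ε < b)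
    (hδ₀ : 0 < δ₀) (hB₁ : 0 ≤ B₁)
    (hHker : ∀ (c'' : T) (Y : Matrix ν ν ℂ) (s : S),
      ‖H (Pi.single c'' Y) s‖ ≤ B₁ * Real.exp (-(δ₀ * ((B7Prop1Explicit.l1 (loK L j c''.1.1 - s.1.1) : ℝ) / (L : ℝ) ^ j))) * ‖Y‖)
    (hq : (C3Gen d L * (((L : ℝ) ^ j) ^ 2 * (2 * ε)) * (2 * d) * B₁ * Real.exp (2 * d * δ₀)) * (d * B6.c0 δ₀ (1 / 2) ^ d) < 1)
    {A' : S → Matrix ν ν ℂ} (hA : ‖A'‖ < ε / 2)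
    (Φ : (S → Matrix ν ν ℂ) →ₗ[ℝ] (S → Matrix ν ν ℂ) →ₗ[ℝ] (T → Matrix ν ν ℂ))
    (hΦ : ∀ (v μ : S → Matrix ν ν ℂ) (c : T), Φ v μ c = fderiv ℂ (fun Y : S → Matrix ν ν ℂ => fderiv ℂ
        (Dfix (Cmap L U₀ S T j) (H : (T → Matrix ν ν ℂ) →ₗ[ℂ] (S → Matrix ν ν ℂ)) ((8 * (131072 * ((d : ℝ) + 1) ^ 2) *
          Real.exp (4 * (800 * ((d : ℝ) + 1) ^ 2 * ((d : ℝ) + 4)) * α₀)) * ((L : ℝ) ^ j) ^ 2)) Y μ) A' v c)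
    {X : T → Matrix ν ν ℂ} {M : ℝ} (hM : 0 ≤ M)
    (hX : ∀ y'', (supSize (cubeGeometry L j S T) (boxT L j S T) (blkT L j S T) :
      BlockNorm (cubeGeometry L j S T) (T → Matrix ν ν ℂ)).loc y'' X ≤ M)
    (W : (S → Matrix ν ν ℂ) →ₗ[ℝ] (S → Matrix ν ν ℂ)) (hW : ∀ v, W v = transposeOf₂ Φ v X) :
    HasMaj (supSize (cubeGeometry L j S T) (boxS L j S T) (blkS L j S T) :
        BlockNorm (cubeGeometry L j S T) (S → Matrix ν ν ℂ))
      (supSize (cubeGeometry L j S T) (boxS L j S T) (blkS L j S T) :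
        BlockNorm (cubeGeometry L j S T) (S → Matrix ν ν ℂ)) W
      (fun y y' => 1 * (1 * (Fintype.card ν * T.card) * (2 / ε * (d * Real.exp (1 / 2 * d * δ₀) *
          ((1 - (C3Gen d L * (((L : ℝ) ^ j) ^ 2 * (2 * ε)) * (2 * d) * B₁ * Real.exp (2 * d * δ₀)) *
              (d * B6.c0 δ₀ (1 / 2) ^ d))⁻¹ * (Real.exp (d * δ₀) * (C3Gen d L * ((L : ℝ) ^ j) ^ 2 * (2 * ε))))))) *
        M * B6.c0 δ₀ (1 / 8) ^ d * Real.exp (-(δ₀ / 8 * (cubeGeometry L j S T).dist y y'))) := by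
  have h := hasMaj₂_d2_Dfix_concrete L hL hG k U₀ hU₀ hα hα3 hα4 h52 hb hsmall hc₃ h145 h155 S T H hj hd hB₀ hH hc1h hε h18 h2
    hq9 hε3 hδ₀ hB₁ hHker hq hA Φ hΦ
  have hQ1 : 0 < 1 - (C3Gen d L * (((L : ℝ) ^ j) ^ 2 * (2 * ε)) * (2 * d) * B₁ * Real.exp (2 * d * δ₀)) *
      (d * B6.c0 δ₀ (1 / 2) ^ d) := by linarith
  have hC3 : 0 ≤ C3Gen d L := by unfold C3Gen C1ppGen; positivity
  exact term189_transpose_cube L j S T (by positivity) hM (by positivity : (0 : ℝ) < 1 / 8 * δ₀) (by positivity)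
    (by linarith) (by linarith) h hX hW

end ConcreteD2

/-! ## §5 (v1.1, append-only)  The concrete SINGLE-OPERATOR transposes `𝔇*` and `H*` — the SHAPE-L letters `Dst`, `Hst` -/

section ConcreteDH

open B7Prop1Explicit B7Prop1Local B7Prop2Explicit B7Prop3Flat B7Prop5GeneralLevels B11Eq44Concrete B11Prop3Model
  B11Prop3Concrete B11HKernelHasMajConcrete

/-- **THE CONCRETE `H*`** (the transposed kernel of (46) ∕ [5] Thm 3.12's `H`, the SHAPE-L letter `Hst` of the census rows T4.3″∕T5.L″):
for an `H : (T → 𝔸) →L[ℂ] (S → 𝔸)`, `𝔸 = Matrix n n ℂ`, with the kernel letter `hHker` (decay `B₁e^{−δ₀|Lʲz_c − s|₁∕Lʲ}`), n07-b's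
`B11HKernelHasMajConcrete.hasMaj_H_of_kernel` gives `H` the majorant `dB₁e^{dδ₀}·e^{−δ₀d}` (coarse → fine); its transpose `transposeOf H`
(fine → coarse) then has the majorant `(n·#S)·dB₁e^{dδ₀}·e^{−δ₀d}` (`hasMaj_transpose_cubeT`). [cite: Balaban1985Variational, (46) p.285 + (90) p.291 + (190) p.308] -/
theorem hasMaj_H_transpose {L : ℕ} (hL : 1 ≤ L) (j : ℕ) (S T : Finset (B7Prop1Explicit.Site d × Fin d))
    (H : (T → Matrix ν ν ℂ) →L[ℂ] (S → Matrix ν ν ℂ)) {B₁ δ₀ : ℝ} (hB₁ : 0 ≤ B₁) (hδ₀ : 0 ≤ δ₀)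
    (hHker : ∀ (c'' : T) (Y : Matrix ν ν ℂ) (s : S),
      ‖H (Pi.single c'' Y) s‖ ≤ B₁ * Real.exp (-(δ₀ * ((l1 (loK L j c''.1.1 - s.1.1) : ℝ) / (L : ℝ) ^ j))) * ‖Y‖) :
    HasMaj (supSize (cubeGeometry L j S T) (boxS L j S T) (blkS L j S T) :
        BlockNorm (cubeGeometry L j S T) (S → Matrix ν ν ℂ))
      (supSize (cubeGeometry L j S T) (boxT L j S T) (blkT L j S T) :
        BlockNorm (cubeGeometry L j S T) (T → Matrix ν ν ℂ))
      (transposeOf (H.restrictScalars ℝ : (T → Matrix ν ν ℂ) →ₗ[ℝ] (S → Matrix ν ν ℂ)))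
      (fun y y' => 1 * (Fintype.card ν * S.card) * (d * B₁ * Real.exp (d * δ₀)) *
        Real.exp (-(δ₀ * (cubeGeometry L j S T).dist y y'))) :=
  hasMaj_transpose_cubeT L j S T (by positivity) (hasMaj_H_of_kernel hL j S T H hB₁ hδ₀ hHker)

variable [Nonempty ν]
variable (L : ℕ) (hL : 2 ≤ L) {G : Subgroup (Matrix ν ν ℂ)ˣ} (hG : AvgClosed d L G) (k : ℕ)
  (U₀ : B7Prop1Explicit.Site d → Fin d → (Matrix ν ν ℂ)ˣ) (hU₀ : ∀ x κ, U₀ x κ ∈ G) {α₀ : ℝ} (hα : 0 < α₀)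
  (hα3 : C0 d * α₀ ≤ 1 / 3) (hα4 : 4 * α₀ ≤ c2' d L) (h52 : pdev U₀ < α₀ * (((L : ℝ) ^ k)⁻¹) ^ 2)
  {b : ℝ} (hb : 0 < b)
  (hsmall : Real.exp (4 * (800 * ((d : ℝ) + 1) ^ 2 * ((d : ℝ) + 4)) * α₀)
    * (1 + 8 * (131072 * ((d : ℝ) + 1) ^ 2) * ((L : ℝ) ^ k * b)) ≤ 2)
  (hc₃ : 4 * ((L : ℝ) ^ k * b) < c3 d L)
  (h145 : 8 * d * thetaGen d L α₀ * (L : ℝ)⁻¹ ^ 4 ≤ 1)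
  (h155 : (2 * (L : ℝ) - 1) * (L : ℝ)⁻¹ ^ 2 + 2 * d * thetaGen d L α₀ * (L : ℝ)⁻¹ ^ 3
    + 1 / 8 * (1 + 2 * d * thetaGen d L α₀ * (L : ℝ)⁻¹ ^ 2 + 2 * d * C3Gen d L * ((L : ℝ) ^ k * b)) * (L : ℝ)⁻¹ ^ 2 ≤ 1)
  (S T : Finset (B7Prop1Explicit.Site d × Fin d)) (H : (T → Matrix ν ν ℂ) →L[ℂ] (S → Matrix ν ν ℂ)) {B₀ B₁ δ₀ ε : ℝ}

include hL hG hU₀ hα hα3 hα4 h52 hb hsmall hc₃ h145 h155 in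
/-- **THE CONCRETE `𝔇*`** (the transposed kernel of (73)'s `𝔇(A′) = (δ∕δA′)D(A′)`, the SHAPE-L letter `Dst` of the census rows T2.3″∕T3″∕
T4.3″∕T5.L″): under EXACTLY the hypotheses of `B11Ineq73HasMajConcrete.hasMaj_fderiv_Dfix` (the (73) letter with decay for the Prop. 3
selector, `‖A′‖ < ε`) at `𝔸 = Matrix n n ℂ`, the transpose `transposeOf (𝔇(A′))` — coarse in, fine out, for the trace form over bonds —
has the majorant `(n·#T)·θ_D·e^{−½δ₀|y−y′|₁}` (`hasMaj_transpose_cubeS`: for one operator the exponential is orientation-free).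
[cite: Balaban1985Variational, (73) p.289 + (88) p.291 + (190) p.308] -/
theorem hasMaj_fderiv_Dfix_transpose {j : ℕ} (hj : j ≤ k) (hB₀ : 0 ≤ B₀) (hH : ∀ X, ‖H X‖ ≤ B₀ * ‖X‖)
    (hq9 : 9 * ((8 * (131072 * ((d : ℝ) + 1) ^ 2) * Real.exp (4 * (800 * ((d : ℝ) + 1) ^ 2 * ((d : ℝ) + 4)) * α₀))
      * ((L : ℝ) ^ j) ^ 2) * B₀ * ε < 1) (hε3 : 3 * ε < b)
    (hδ₀ : 0 < δ₀) (hB₁ : 0 ≤ B₁)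
    (hHker : ∀ (c'' : T) (Y : Matrix ν ν ℂ) (s : S),
      ‖H (Pi.single c'' Y) s‖ ≤ B₁ * Real.exp (-(δ₀ * ((B7Prop1Explicit.l1 (loK L j c''.1.1 - s.1.1) : ℝ) / (L : ℝ) ^ j))) * ‖Y‖)
    (hq : (C3Gen d L * (((L : ℝ) ^ j) ^ 2 * (2 * ε)) * (2 * d) * B₁ * Real.exp (2 * d * δ₀)) * (d * B6.c0 δ₀ (1 / 2) ^ d) < 1)
    (hε : 0 ≤ ε) {A' : S → Matrix ν ν ℂ} (hA : ‖A'‖ < ε) :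
    HasMaj (supSize (cubeGeometry L j S T) (boxT L j S T) (blkT L j S T) :
        BlockNorm (cubeGeometry L j S T) (T → Matrix ν ν ℂ))
      (supSize (cubeGeometry L j S T) (boxS L j S T) (blkS L j S T) :
        BlockNorm (cubeGeometry L j S T) (S → Matrix ν ν ℂ))
      (transposeOf ((fderiv ℂ (Dfix (Cmap L U₀ S T j) (H : (T → Matrix ν ν ℂ) →ₗ[ℂ] (S → Matrix ν ν ℂ))
          ((8 * (131072 * ((d : ℝ) + 1) ^ 2) * Real.exp (4 * (800 * ((d : ℝ) + 1) ^ 2 * ((d : ℝ) + 4)) * α₀)) *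
            ((L : ℝ) ^ j) ^ 2)) A').restrictScalars ℝ : (S → Matrix ν ν ℂ) →ₗ[ℝ] (T → Matrix ν ν ℂ)))
      (fun y y' => 1 * (Fintype.card ν * T.card) * (d * Real.exp (1 / 2 * d * δ₀) *
          ((1 - (C3Gen d L * (((L : ℝ) ^ j) ^ 2 * (2 * ε)) * (2 * d) * B₁ * Real.exp (2 * d * δ₀)) *
              (d * B6.c0 δ₀ (1 / 2) ^ d))⁻¹ * (Real.exp (d * δ₀) * (C3Gen d L * ((L : ℝ) ^ j) ^ 2 * (2 * ε))))) *
        Real.exp (-(δ₀ / 2 * (cubeGeometry L j S T).dist y y'))) := by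
  have h := hasMaj_fderiv_Dfix L hL hG k U₀ hU₀ hα hα3 hα4 h52 hb hsmall hc₃ h145 h155 S T H hj hB₀ hH hq9 hε3 hδ₀ hB₁ hHker hq
    hε hA
  have hQ1 : 0 < 1 - (C3Gen d L * (((L : ℝ) ^ j) ^ 2 * (2 * ε)) * (2 * d) * B₁ * Real.exp (2 * d * δ₀)) *
      (d * B6.c0 δ₀ (1 / 2) ^ d) := by linarith
  have hC3 : 0 ≤ C3Gen d L := by unfold C3Gen C1ppGen; positivity
  exact hasMaj_transpose_cubeS L j S T
    (mul_nonneg (by positivity) (mul_nonneg (inv_nonneg.2 hQ1.le) (by positivity))) h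

end ConcreteDH

end

end Literature.MathematicalPhysics.QuantumFieldTheory.Balaban1983to89.B11Ineq189TransposeCube
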